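import Summits.QuantumFields.YangMills.Theorems.PoincareLipschitzHistoryTailOfFactsQuantile
import Summits.QuantumFields.YangMills.Theorems.PoincareLipschitzHistoryTailOfSobolevStubs
import Summits.QuantumFields.YangMills.Theorems.PoincareLipschitzMinimisingMapCompactnessHolds
import HarnessLib

/-!
# Crux `HistoryTailL` (stmt-QuantumFields-19936) — FILE K-13: the K2-LANE FACE v9 «COMPACTNESS IS A THEOREM»
# (secondary face of record, ★★OWNER RULING №28; the display of record is the one-row sandwich face ✓p729779)

Cell `ym3-torus` (YM ladder rung R3 = continuum SU(2) Yang–Mills on T³ — a RUNG, NOT the Clay problem: not d = 4, not infinite volume, not a mass gap);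
LEAD seat `ym-ust-19936-w1` g10.  Helper `--supports stmt-QuantumFields-19936`; THEOREMS ONLY; one-line instantiations of the K2-lane face v8 ✓p730074
(`PoincareLipschitzHistoryTailOfFactsQuantile`) at `hC := minimisingMapCompactness_holds` — w2 g13's lineage theorem
✓`PoincareLipschitzMinimisingMapCompactnessHolds.minimisingMapCompactness_holds : Literature.Analysis.PDE.MinimisingMapCompactness` (compactness of energy
minimising maps `Q → S³` [Luckhaus 1988 ∕ Simon 1996 §2.9 Lemma 1], PROVED in the tree via the Hardt–Kinderlehrer–Lin ray projection: w2 (C-a…e), w4 g15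
(C-c∕C-bc), px22 (C-b-AVG), ★w3 (C-b-β), px14 (C-d0), px16 (C-d)).

THE DISPLAYED BINDERS (v9).  `hK1` = K1-exp (crux stmt-QuantumFields-23532's exponential letter, v2–v8 VERBATIM); `hT : Literature.Analysis.PDE.MinimisingTangentMapConstant`
[Schoen–Uhlenbeck 1984, Prop. 1.2: a radially constant ball-minimiser `Q → S³` is constant] — THE ONLY NAMED PRINT FACT LEFT ON THE FACE (★px3 g9's (TM)
road; its stability∕Hardy half `Θ ≤ 3π` is being typed, the `8π`-gap half stays print); `hQ` = (Q) = LINE 27 `stub_quantileDeviation` (3∕4-quantile;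
⊂ `MeanDeviationL`, stmt-QuantumFields-23083; px10 g6) resp. `hM` = `MeanDeviationL` itself; `hR : MinimisingMapSmoothness` for the smoothness flavour.
Census v8 → v9: removed [hC] · added [] · changed [].  NOTHING of K1-exp, (TM)∕(RS), (Q) or `MeanDeviationL` is proved here; `HistoryTailL` is NOT proved.

WHAT IS PROVED (ns `…Theorems.PoincareLipschitzHistoryTailOfTangentMapFact`).
* ★★★ `blockLipschitzL_of_tangentMapFact (hT) : PoincareLipschitz.BlockLipschitzL` — THE K2 CRUX stmt-QuantumFields-23533 MODULO ONE NAMED PRINT FACT.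
* ★★★ `blockLipschitzL_of_smoothnessFact (hR) : PoincareLipschitz.BlockLipschitzL` — the same in the smoothness flavour [SU84 Thm 2.7].
* ★★★ `historyTailL_of_tangentMapFact_quantile (hK1) (hT) (hQ) : UnitScaleTilt.HistoryTailL` — the K2-lane face v9 (three rows).
* ★★★ `historyTailL_of_tangentMapFact (hK1) (hT) (hM) : UnitScaleTilt.HistoryTailL` — the same with the crux `MeanDeviationL` as the first-moment row.
HONEST SCOPE.  Instantiations by landed names only; YM₃ on T³ is rung R3, not Clay; YM gap NOT proved.

References: T. Bałaban, CMP 102 (1985) 255–275 [Balaban1985UV3]; R. Schoen, K. Uhlenbeck, Invent. Math. 78 (1984) 89–100 [SchoenUhlenbeck1984]; L. Simon (1996)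
[Simon1996]; S. Luckhaus (1988) [Luckhaus1988]; R. Hardt, D. Kinderlehrer, F.-H. Lin, CMP 105 (1986) 547–570 [HardtKinderlehrerLin1986].
-/

set_option autoImplicit false

noncomputable section

namespace Summit.QuantumFields.YangMills.Theorems.PoincareLipschitzHistoryTailOfTangentMapFact

open MeasureTheory Filter Topology Finset Metric
open scoped BigOperators
open Literature.Analysis.FunctionSpaces
open Literature.Analysis.PDE (MinimisingMapCompactness MinimisingMapSmoothness MinimisingTangentMapConstant)
open Literature.MathematicalPhysics.QuantumFieldTheory.Balaban1983to89
open Literature.MathematicalPhysics.QuantumFieldTheory.Balaban1983to89.T3ContinuumYM3Torus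
open Literature.MathematicalPhysics.QuantumFieldTheory.Balaban1983to89.T3UnitScaleTilt
open Literature.MathematicalPhysics.QuantumFieldTheory.Balaban1983to89.T3UnitLawDensityEML (ℰp)
open B4Eq19LatticeOperators (Zd box unitVec)
open Summit.QuantumFields.YangMills.Theorems.PoincareLipschitzHistoryTailOfFactsQuantile
  (blockLipschitzL_of_facts blockLipschitzL_of_compactness_tangentMaps historyTailL_of_compactness_tangentMaps_quantile)
open Summit.QuantumFields.YangMills.Theorems.PoincareLipschitzHistoryTailOfSobolevStubs (historyTailL_of_stubs)
open Summit.QuantumFields.YangMills.Theorems.PoincareLipschitzFlatOrganOfSobolevStubs (hImproveCoreFlat_of_stubs)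
open Summit.QuantumFields.YangMills.Theorems.PoincareLipschitzUniformSmallScaleEnergyOfTangentMaps (uniformSmallScaleEnergy_band_of_compactness_tangentMaps)
open Summit.QuantumFields.YangMills.Theorems.PoincareLipschitzCompactnessTransferLatticeToContinuumLimitStub (stub_latticeToContinuumLimit)
open Summit.QuantumFields.YangMills.Theorems.PoincareLipschitzMinimisingMapCompactnessHolds (minimisingMapCompactness_holds)

/-- ★★★ **THE K2 CRUX `BlockLipschitzL` (stmt-QuantumFields-23533) MODULO ONE NAMED PRINT FACT** — compactness is now the theorem
`minimisingMapCompactness_holds`. [cite: SchoenUhlenbeck1984, Prop. 1.2; Luckhaus1988, Thm 2] -/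
theorem blockLipschitzL_of_tangentMapFact (hT : MinimisingTangentMapConstant) :
    Summit.QuantumFields.YangMills.Theses.PoincareLipschitz.BlockLipschitzL :=
  blockLipschitzL_of_compactness_tangentMaps minimisingMapCompactness_holds hT

/-- ★★★ **THE K2 CRUX MODULO ONE NAMED PRINT FACT, SMOOTHNESS FLAVOUR.** [cite: SchoenUhlenbeck1984, Thm; Luckhaus1988, Thm 2] -/
theorem blockLipschitzL_of_smoothnessFact (hR : MinimisingMapSmoothness) :
    Summit.QuantumFields.YangMills.Theses.PoincareLipschitz.BlockLipschitzL :=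
  blockLipschitzL_of_facts minimisingMapCompactness_holds hR

/-- ★★★ **THE K2-LANE FACE v9: THE CRUX BY NAME FROM K1-exp, THE NAMED FACT `MinimisingTangentMapConstant` AND THE QUANTILE ROW (Q).**
[cite: Balaban1985UV3, (71) p.273; SchoenUhlenbeck1984, Prop. 1.2] -/
theorem historyTailL_of_tangentMapFact_quantile
    (hK1 : ∀ (L : ℕ), ∃ (Cc cc : ℝ), 0 ≤ Cc ∧ 0 < cc ∧ ∃ γ₁ : ℝ, 0 < γ₁ ∧ γ₁ ≤ 1 ∧
      ∀ (F : T3Family) (γ : ℝ), F.L = L → 0 < γ → γ ≤ γ₁ → ∀ (K n : ℕ), 1 ≤ n →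
        (n : ℝ) ≤ (F.scheme ℰp γ).β K → 2 * n ≤ (F.P K).sitesPerDir 0 →
        ∀ (x₀ : Site (F.P K) 0) (f : GaugeField (F.P K) 0 (Matrix.specialUnitaryGroup (Fin 2) ℂ) → ℝ) (Λ : ℝ), 0 < Λ →
          Measurable f → GaugeField.GaugeInvariant f →
          (∀ U U' : GaugeField (F.P K) 0 (Matrix.specialUnitaryGroup (Fin 2) ℂ),
            (∀ b : PBond (F.P K) 0, (∀ k, (b.src k - x₀ k).val < n) → (∀ k, (b.tgt k - x₀ k).val < n) → U b = U' b) →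
              f U = f U') →
          (∀ U U' : GaugeField (F.P K) 0 (Matrix.specialUnitaryGroup (Fin 2) ℂ),
            |f U - f U'| ≤ Λ * Real.sqrt (∑ b : PBond (F.P K) 0, GaugeGroup.dist1 (U b * (U' b)⁻¹) ^ 2)) →
          ∀ r : ℝ, 0 ≤ r →
            (gibbsK F ℰp γ K).real {U | r ≤ f U - ∫ V, f V ∂(gibbsK F ℰp γ K)} ≤
              Cc * Real.exp (-(cc * Real.sqrt ((F.scheme ℰp γ).β K) * r / ((n : ℝ) * Λ))))
    (hT : MinimisingTangentMapConstant)
    (hQ : ∀ (L : ℕ) (b₀ p₀ : ℝ), 0 < b₀ → 2 < p₀ → ∃ γ₁ : ℝ, 0 < γ₁ ∧ γ₁ ≤ 1 ∧ ∀ (F : T3Family) (γ : ℝ), F.L = L → 0 < γ → γ ≤ γ₁ →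
            ∀ (K j : ℕ), 1 ≤ j → j + 2 ≤ K → ∀ a : Plaq (F.P K) j,
              3 / 4 ≤ (gibbsK F ℰp γ K).real {U : GaugeField (F.P K) 0 (Matrix.specialUnitaryGroup (Fin 2) ℂ) | GaugeGroup.dist1 (GaugeField.plaqHol (Averaging.iter (fun i' => BlockAveraging.blockAvg (P := F.P K) (j := i') ℰp) j U) a) ≤ θBal F.L γ b₀ p₀ (K - j) / 8})
    : Summit.QuantumFields.YangMills.Theses.UnitScaleTilt.HistoryTailL :=
  historyTailL_of_compactness_tangentMaps_quantile hK1 minimisingMapCompactness_holds hT hQ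

/-- ★★★ **THE SAME WITH THE CRUX `MeanDeviationL` (stmt-QuantumFields-23083) AS THE FIRST-MOMENT ROW.** [cite: Balaban1985UV3, (71) p.273; SchoenUhlenbeck1984, Prop. 1.2] -/
theorem historyTailL_of_tangentMapFact
    (hK1 : ∀ (L : ℕ), ∃ (Cc cc : ℝ), 0 ≤ Cc ∧ 0 < cc ∧ ∃ γ₁ : ℝ, 0 < γ₁ ∧ γ₁ ≤ 1 ∧
      ∀ (F : T3Family) (γ : ℝ), F.L = L → 0 < γ → γ ≤ γ₁ → ∀ (K n : ℕ), 1 ≤ n →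
        (n : ℝ) ≤ (F.scheme ℰp γ).β K → 2 * n ≤ (F.P K).sitesPerDir 0 →
        ∀ (x₀ : Site (F.P K) 0) (f : GaugeField (F.P K) 0 (Matrix.specialUnitaryGroup (Fin 2) ℂ) → ℝ) (Λ : ℝ), 0 < Λ →
          Measurable f → GaugeField.GaugeInvariant f →
          (∀ U U' : GaugeField (F.P K) 0 (Matrix.specialUnitaryGroup (Fin 2) ℂ),
            (∀ b : PBond (F.P K) 0, (∀ k, (b.src k - x₀ k).val < n) → (∀ k, (b.tgt k - x₀ k).val < n) → U b = U' b) →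
              f U = f U') →
          (∀ U U' : GaugeField (F.P K) 0 (Matrix.specialUnitaryGroup (Fin 2) ℂ),
            |f U - f U'| ≤ Λ * Real.sqrt (∑ b : PBond (F.P K) 0, GaugeGroup.dist1 (U b * (U' b)⁻¹) ^ 2)) →
          ∀ r : ℝ, 0 ≤ r →
            (gibbsK F ℰp γ K).real {U | r ≤ f U - ∫ V, f V ∂(gibbsK F ℰp γ K)} ≤
              Cc * Real.exp (-(cc * Real.sqrt ((F.scheme ℰp γ).β K) * r / ((n : ℝ) * Λ))))
    (hT : MinimisingTangentMapConstant)
    (hM : Summit.QuantumFields.YangMills.Theses.PoincareLipschitz.MeanDeviationL) :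
    Summit.QuantumFields.YangMills.Theses.UnitScaleTilt.HistoryTailL :=
  historyTailL_of_stubs hK1 (uniformSmallScaleEnergy_band_of_compactness_tangentMaps minimisingMapCompactness_holds hT)
    stub_latticeToContinuumLimit hM

end Summit.QuantumFields.YangMills.Theorems.PoincareLipschitzHistoryTailOfTangentMapFact

end
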